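import Summits.CriticalPhenomena.PercolationContinuityZ3.Theorems.PercNearOneGluingNoHeavyQuantGatedSliceMixLawQKCellsC
import Summits.CriticalPhenomena.PercolationContinuityZ3.Theorems.PercNearOneGluingNoHeavyQuantGatedSliceMixLawQ4TopMid
import Summits.CriticalPhenomena.PercolationContinuityZ3.Theorems.PercNearOneGluingNoHeavyQuantGatedSliceMixLawQHGiantTop
import Summits.CriticalPhenomena.PercolationContinuityZ3.Theorems.PercNearOneGluingNoHeavyQuantGatedSliceMixLawCellsEasy
import Summits.CriticalPhenomena.PercolationContinuityZ3.Theorems.PercNearOneGluingNoHeavyQuantGatedSliceMixLawQTwinGiant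
import HarnessLib

/-!
# QUANT lane R8, T-DEC, leg (III), blob case — `LawDec.GatedSliceMixLaw'`, Q-ALONE side: **cells Q4 and QH HOLD**
# (`mixLawCellQ4_holds : MixLawCellQ4`, `mixLawCellQH_holds : MixLawCellQH`)

builds on p205010 (kernel theorem, internal audit signed; external expert review pending)

Support file (`--supports stmt-CriticalPhenomena-4575`), QUANT lane seat prim-quant-arm-1 (gen 41), rung R8 of `run/shared/lean/prim/quant/LADDER.md`.
Theorems only, standard axioms, no sorries, no definitions.  Pure case assembly of the landed class theorems of this seat:
`mixLawCellQ1_holds` (`k₂ + a ≤ j`), `mixLawQ_decAtT_of_twinGiant` (`k₁ + a ≥ j+1`), `mixLawCellQ2_holds` / `mixLawQ_decAtT_of_noLow`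
(no nonzero low), `mixLawQ_decAtT_cellQ4_topMid` (`…Q4TopMid`: top a mid), `mixLawQ_decAtT_cellQK` (`…QKCellsC`: top a low),
`mixLawQ_decAtT_qh_giantTop` (`…QHGiantTop`: top a giant, `2S < t`).
* **`mixLawCellQ4_holds`** — typer g30's cell Q4 (`k₁` a `t`-low or zero, twin `k₁ + a ≤ j` a mid, top `k₂ ≤ j`): `k₂ + a ≤ j` → Q1; top a
  low → cell QK; top a mid → `…cellQ4_topMid`.
* **`mixLawCellQH_holds`** — typer g30's cell QH (`2S < t`): `k₂ + a ≤ j` → Q1; twin a giant → `…twinGiant`; `k₁` not low → Q2; top a giant →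
  `…qh_giantTop` (`k₁ ≥ 1`) / no nonzero low (`k₁ = 0`); top a low → cell QK; top a mid → `…cellQ4_topMid` (in QH `t < 2a ≤ 2(k₁+a)`).
With `mixLawCellQK_holds` (`…QKCellsC`) these are the three residual Q-alone cells of the assembly `gatedSliceMixLaw'_of_residualCells`
(`…QuantGatedSliceMixLawAssemblyA`, typer g30); what remains there is the typer's `MixLawCellA5` and census-2's `MixLawRegimeB`.
HONEST STATUS: `GatedSliceMixLaw'` (regime R) OPEN modulo A5 + regime B; CW, `GateMove`, `GatedConvEmptyFree`, `SingleGateConvClosed`, `TreeDEC`,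
`FarTreeRow` OPEN; RATE class log\* / honest sentence of `run/shared/lean/prim/quant/README.md` unchanged.

[this work]; binders: prim-quant-typer g30; node: prim-quant-stmt g29/g30 (this lane).  Nothing here is cited as a published result.
The gluing rows served [cite: KozmaNitzan2024, Conjecture 3 (p. 15)]; product measure [cite: Grimmett1999, §1.3 p. 10].
-/

noncomputable section

namespace Summit.CriticalPhenomena.PercolationContinuityZ3.Theorems

namespace Quant

open Finset

/-- the two-point law `{lo, hi; g}` (as in `…QuantLawDEC`) -/
local notation3 "TP[" lo ", " hi ", " g ", " h "]" =>
  (g : ℝ) * (if (h : ℕ) = (hi : ℕ) then (1 : ℝ) else 0) + (1 - (g : ℝ)) * (if (h : ℕ) = (lo : ℕ) then (1 : ℝ) else 0)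

namespace LawDec

/-- **CELL Q4 HOLDS** (typer g30's binder `MixLawCellQ4`). [this work] -/
theorem mixLawCellQ4_holds : MixLawCellQ4 := by
  intro y z g S lam a j M k₁ k₂ hy0 hy1 hz0 hz1 hg1 hyg ha hjM hS0 hta hSj hSM hk hk₂M hlam0 hlam1 hmean hk₁j hk₁low hPj hPmid hKj
  by_cases htop : k₂ + a ≤ j
  · exact mixLawCellQ1_holds y z g S lam a j M k₁ k₂ hy0 hy1 hz0 hz1 hg1 hyg ha hjM hS0 hta hSj hSM hk hk₂M hlam0 hlam1 hmean htop
  have hG : j + 1 ≤ k₂ + a := by omega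
  by_cases hKlow : 2 * (k₂ : ℝ) < S + (a : ℝ) * g * (1 - z)
  · exact mixLawQ_decAtT_cellQK y z g S lam a j M k₁ k₂ hy0 hy1 hz0 hz1 hg1 hyg ha hta hk hk₂M hlam0 hlam1 hmean hk₁j hk₁low hPj hPmid
      hKj hKlow hG
  · exact mixLawQ_decAtT_cellQ4_topMid y z g S lam a j M k₁ k₂ hy0 hy1 hz0 hz1 hg1 hyg ha hta hk hk₂M hlam0 hlam1 hmean hk₁j hk₁low
      hPj hPmid hKj (not_lt.1 hKlow) hG

/-- **CELL QH HOLDS** (typer g30's binder `MixLawCellQH`, `2S < t`). [this work] -/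
theorem mixLawCellQH_holds : MixLawCellQH := by
  intro y z g S lam a j M k₁ k₂ hy0 hy1 hz0 hz1 hg1 hyg ha hjM hS0 hta hSj hSM hk hk₂M hlam0 hlam1 hmean hQH
  by_cases htop : k₂ + a ≤ j
  · exact mixLawCellQ1_holds y z g S lam a j M k₁ k₂ hy0 hy1 hz0 hz1 hg1 hyg ha hjM hS0 hta hSj hSM hk hk₂M hlam0 hlam1 hmean htop
  have hG : j + 1 ≤ k₂ + a := by omega
  by_cases hPgiant : j + 1 ≤ k₁ + a
  · exact mixLawQ_decAtT_of_twinGiant y z g S lam a j M k₁ k₂ hy0 hy1 hz0 hz1 hg1 hyg ha hjM hk hk₂M hlam0 hlam1 hPgiant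
  have hPj : k₁ + a ≤ j := by omega
  by_cases hlow : ¬ (k₁ ≤ j ∧ 2 * (k₁ : ℝ) < S + (a : ℝ) * g * (1 - z))
  · exact mixLawCellQ2_holds y z g S lam a j M k₁ k₂ hy0 hy1 hz0 hz1 hg1 hyg ha hjM hS0 hta hSj hSM hk hk₂M hlam0 hlam1 hmean hlow
  obtain ⟨hk₁j, hk₁low⟩ := not_not.1 hlow
  -- in QH `t < 2a ≤ 2(k₁ + a)`
  have h1z : 0 < 1 - z := by linarith
  have hg0 : 0 < g := by
    by_contra hc
    have : (1 - z) * g ≤ 0 := mul_nonpos_of_nonneg_of_nonpos (by linarith) (not_lt.1 hc)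
    linarith
  have hagz : (a : ℝ) * g * (1 - z) ≤ a := by
    have h5 : g * (1 - z) ≤ 1 := by
      calc g * (1 - z) ≤ g * 1 := mul_le_mul_of_nonneg_left (by linarith) hg0.le
        _ ≤ 1 := by linarith
    have h6 := mul_le_mul_of_nonneg_left h5 (Nat.cast_nonneg a)
    linarith [h6, show (a : ℝ) * g * (1 - z) = (a : ℝ) * (g * (1 - z)) by ring]
  have hPmid : S + (a : ℝ) * g * (1 - z) ≤ 2 * ((k₁ + a : ℕ) : ℝ) := by
    have : (0 : ℝ) ≤ k₁ := Nat.cast_nonneg k₁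
    push_cast; linarith
  by_cases hKG : j + 1 ≤ k₂
  · -- the top is a giant
    rcases Nat.eq_zero_or_pos k₁ with h0 | hpos
    · -- `k₁ = 0`: no nonzero low
      subst h0
      refine mixLawQ_decAtT_of_noLow y z g S lam a j M 0 k₂ hy0 hy1 hz0 hz1 hg1 hyg ha hta hk hk₂M hlam0 hlam1 hmean ?_
      intro l hl1 hlj hlow'
      have hl0 : l ≠ 0 := by omega
      have hla : l ≠ 0 + a := by
        intro h
        have : 2 * (l : ℝ) = 2 * ((0 + a : ℕ) : ℝ) := by rw [h]
        linarith
      have hlK : l ≠ k₂ := by omega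
      have hlG : l ≠ k₂ + a := by omega
      rw [mixLawQ_eq_atoms, if_neg hl0, if_neg hla, if_neg hlK, if_neg hlG]
      ring
    · exact mixLawQ_decAtT_qh_giantTop y z g S lam a j M k₁ k₂ hy0 hy1 hz0 hz1 hg1 hyg ha hta hk hk₂M hlam0 hlam1 hmean hpos hk₁j
        hk₁low hPj hPmid hKG hQH
  have hKj : k₂ ≤ j := by omega
  by_cases hKlow : 2 * (k₂ : ℝ) < S + (a : ℝ) * g * (1 - z)
  · exact mixLawQ_decAtT_cellQK y z g S lam a j M k₁ k₂ hy0 hy1 hz0 hz1 hg1 hyg ha hta hk hk₂M hlam0 hlam1 hmean hk₁j hk₁low hPj hPmid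
      hKj hKlow hG
  · exact mixLawQ_decAtT_cellQ4_topMid y z g S lam a j M k₁ k₂ hy0 hy1 hz0 hz1 hg1 hyg ha hta hk hk₂M hlam0 hlam1 hmean hk₁j hk₁low
      hPj hPmid hKj (not_lt.1 hKlow) hG

end LawDec

end Quant

end Summit.CriticalPhenomena.PercolationContinuityZ3.Theorems
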